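import Summits.Ventures.WeilGRH.GramFormExclusion
import Summits.Ventures.WeilGRH.ChristoffelCertificate
import HarnessLib

/-!
# rh-explicit (venture WeilGRH): CHRISTOFFEL CERTIFICATES, II — the block checker `Christoffel.checkCert`, its soundness, and
  the two theorems a passing certificate buys (weil-3 gen16)

Cell `rh-explicit`, WEIL TRACK (structure seat weil-3, gen16).  Continuation of `ChristoffelCertificate.lean` (form box and
piecewise profile box with their inclusion theorems).  Here: the pieces `[e_k, e_{k+1}]` of a block `[p/q, p'/q]`
(`Christoffel.pieceBox`, `pieceCentre`, `exists_piece`), the checker `Christoffel.checkCert` (accept iff the form box lies strictly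
below every piece's profile box), `Christoffel.certificate_sound` (then `xᵀG_a x < m ≤ ‖û(½+it)‖²` on the block with
`m = (F.hi + ½)/S`), and — via `GramFormExclusion` — ★ `Christoffel.measure_Icc_eq_zero_of_natValued_of_checkCert` (every
ℕ-valued Weil measure of the rung vanishes on the block) and ★ `Christoffel.im_not_mem_Icc_of_riemannHypothesis_of_checkCert`
(under RH no ordinate of a zero of `ζ` lies in it); the multiplicity checker `Christoffel.checkCertMul` (its soundness is part III,
`ChristoffelCertificateMul.lean`).  RH-free except where named; standard axioms; nothing here bears on the truth of RH.
-/

set_option autoImplicit false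

noncomputable section

open Complex Set MeasureTheory
open scoped Real ENNReal

namespace Summit.Ventures.WeilGRH

open Literature.NumberTheory.LFunctions
open Literature.NumberTheory.LFunctions.Yoshida1992 (chi gramCoeff freq PrimeLen PrimeData)
open Literature.NumberTheory.LFunctions.Yoshida1992.Encl (Consts IdxRec ConstsValid OffValid DiagValid IdxValid TabValid
  tget gramBox mem_gramBox sgn neg_one_zpow_eq_sgn mem_of_eq)
open Literature.Analysis.ValidatedNumerics.NumericsMP (MI MC)
open Literature.NumberTheory.LFunctions.ZetaZeros (riemannZetaNontrivialZeros)
open Summit.RiemannHypothesis.RiemannHypothesis.Theorems.WeilFormatC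
open Summit.RiemannHypothesis.RiemannHypothesis.Theorems.WeilBochnerMeasure (weilMellin_sum_smul_chi)

variable {a : ℝ}

/-! ## The profile for every `t`: `χ̂_n(½+it) = √(2a)·sinc(at + πn)` -/

/-- **`χ̂_n(½+it) = √(2a)·sinc(at + πn)`** for EVERY real `t` (`a > 0`): at the lattice point `t = −πn/a` both sides
are `√(2a)`, elsewhere this is `weilMellin_chi_eq_sinc`. -/
theorem weilMellin_chi_eq_sqrt_mul_sinc (ha : 0 < a) (n : ℤ) (t : ℝ) :
    weilMellin (chi a n) (1 / 2 + t * I) = ((Real.sqrt (2 * a) * Real.sinc (a * t + π * n) : ℝ) : ℂ) := by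
  have hy : a * t + π * n = a * (t + π * n / a) := by field_simp
  by_cases h : t + π * n / a = 0
  · have hy0 : a * t + π * n = 0 := by rw [hy, h, mul_zero]
    rw [hy0, Real.sinc_zero, mul_one]
    have hchi : chi a n = fun y ↦ cexp (I * ((π * n / a) * y : ℝ)) * chi a 0 y := by
      funext y
      by_cases hy' : y ∈ Icc (-a) a
      · rw [chi_apply_of_mem n hy', chi_apply_of_mem 0 hy']
        simp only [Int.cast_zero, mul_zero, zero_mul, zero_div, Complex.exp_zero, mul_one]
        rw [mul_comm]
        congr 1
        push_cast
        ring_nf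
      · rw [chi_apply_of_not_mem n hy', chi_apply_of_not_mem 0 hy', mul_zero]
    rw [hchi, weilMellin_modulate, h]
    exact weilMellin_chi_zero_zero ha
  · rw [weilMellin_chi_eq_sinc ha n h]
    have hy0 : a * t + π * n ≠ 0 := by rw [hy]; exact mul_ne_zero ha.ne' h
    rw [Real.sinc_of_ne_zero hy0]
    have hsin : Real.sin (a * t + π * n) = (-1) ^ n * Real.sin (a * t) := by
      rw [show a * t + π * n = a * t + n * π by ring, Real.sin_add_int_mul_pi]
    rw [hsin]
    have hs : Real.sqrt (2 * a) ≠ 0 := (Real.sqrt_pos.2 (by linarith)).ne'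
    have hsq : Real.sqrt (2 * a) ^ 2 = 2 * a := Real.sq_sqrt (by linarith)
    congr 1
    -- write `2 = √(2a)²/a` and clear denominators
    have key : (2 : ℝ) / Real.sqrt (2 * a) = Real.sqrt (2 * a) / a := by
      rw [div_eq_div_iff hs ha.ne', ← sq, hsq]
    calc (-1 : ℝ) ^ n * (2 * Real.sin (a * t)) / ((t + π * n / a) * Real.sqrt (2 * a))
        = (-1 : ℝ) ^ n * Real.sin (a * t) / (t + π * n / a) * (2 / Real.sqrt (2 * a)) := by
          field_simp
      _ = (-1 : ℝ) ^ n * Real.sin (a * t) / (t + π * n / a) * (Real.sqrt (2 * a) / a) := by rw [key]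
      _ = Real.sqrt (2 * a) * ((-1) ^ n * Real.sin (a * t) / (a * t + π * n)) := by
          rw [hy]
          field_simp

/-- **The profile as a `sinc` sum, for every `t`**: `‖(Σ_{n∈s} x_n χ_n)^(½+it)‖² = 2a·(Σ_{n∈s} x_n sinc(at + πn))²`. -/
theorem norm_sq_weilMellin_sum_smul_chi_eq_sinc (ha : 0 < a) (s : Finset ℤ) (x : ℤ → ℝ) (t : ℝ) :
    ‖weilMellin (∑ n ∈ s, (x n : ℂ) • chi a n) (1 / 2 + t * I)‖ ^ 2 =
      2 * a * (∑ n ∈ s, x n * Real.sinc (a * t + π * n)) ^ 2 := by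
  rw [weilMellin_sum_smul_chi a s (fun n ↦ (x n : ℂ)) t]
  have e : ∑ n ∈ s, (x n : ℂ) * weilMellin (chi a n) (1 / 2 + t * I) =
      ((Real.sqrt (2 * a) * ∑ n ∈ s, x n * Real.sinc (a * t + π * n) : ℝ) : ℂ) := by
    push_cast
    rw [Finset.mul_sum]
    refine Finset.sum_congr rfl fun n _ ↦ ?_
    rw [weilMellin_chi_eq_sqrt_mul_sinc ha n t]
    push_cast
    ring
  rw [e, Complex.norm_real, Real.norm_eq_abs, sq_abs, mul_pow, Real.sq_sqrt (by linarith)]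

namespace Christoffel

variable {S : ℕ} {ks : List PrimeLen} {C : Consts} {tab : List IdxRec} {Nt : ℕ}

/-! ## Pieces of the block and the checker -/

/-- The `k`-th of `K` pieces of `[p/q, p'/q]`, as a scaled interval. -/
def pieceBox (S : ℕ) (p p' : ℤ) (q K k : ℕ) : MI :=
  MI.span (MI.ofFrac S (p * ((K : ℤ) - k) + p' * k) (q * K))
    (MI.ofFrac S (p * ((K : ℤ) - (k + 1 : ℕ)) + p' * (k + 1 : ℕ)) (q * K))

/-- The centre of the `k`-th piece, as a scaled (thin) interval. -/
def pieceCentre (S : ℕ) (p p' : ℤ) (q K k : ℕ) : MI :=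
  MI.ofFrac S (p * (2 * (K : ℤ) - 2 * k - 1) + p' * (2 * k + 1)) (2 * q * K)

/-- The piece endpoint `e_k = (p(K−k) + p'k)/(qK)`. -/
def pieceEnd (p p' : ℤ) (q K k : ℕ) : ℝ := ((p * ((K : ℤ) - k) + p' * k : ℤ) : ℝ) / ((q * K : ℕ) : ℝ)

/-- The `k`-th piece box contains every `t` between its endpoints. -/
theorem mem_pieceBox (S : ℕ) {p p' : ℤ} {q K : ℕ} (hq : 0 < q) (hK : 0 < K) (k : ℕ) {t : ℝ}
    (h1 : pieceEnd p p' q K k ≤ t) (h2 : t ≤ pieceEnd p p' q K (k + 1)) : MI.mem S t (pieceBox S p p' q K k) :=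
  MI.mem_span (MI.mem_ofFrac S _ (Nat.mul_pos hq hK)) (MI.mem_ofFrac S _ (Nat.mul_pos hq hK)) h1 h2

/-- The first piece starts at `p/q`. -/
theorem pieceEnd_zero {p p' : ℤ} {q K : ℕ} (hq : 0 < q) (hK : 0 < K) : pieceEnd p p' q K 0 = (p : ℝ) / q := by
  unfold pieceEnd
  have hq' : (q : ℝ) ≠ 0 := by exact_mod_cast hq.ne'
  have hK' : (K : ℝ) ≠ 0 := by exact_mod_cast hK.ne'
  push_cast
  field_simp
  ring

/-- The last piece ends at `p'/q`. -/
theorem pieceEnd_last {p p' : ℤ} {q K : ℕ} (hq : 0 < q) (hK : 0 < K) : pieceEnd p p' q K K = (p' : ℝ) / q := by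
  unfold pieceEnd
  have hq' : (q : ℝ) ≠ 0 := by exact_mod_cast hq.ne'
  have hK' : (K : ℝ) ≠ 0 := by exact_mod_cast hK.ne'
  push_cast
  field_simp
  ring

/-- Every point of `[p/q, p'/q]` lies in one of the `K` pieces. -/
theorem exists_piece {p p' : ℤ} {q K : ℕ} (hq : 0 < q) (hK : 0 < K) {t : ℝ}
    (ht : t ∈ Icc ((p : ℝ) / q) ((p' : ℝ) / q)) :
    ∃ k < K, pieceEnd p p' q K k ≤ t ∧ t ≤ pieceEnd p p' q K (k + 1) := by
  by_contra hcon
  have hcon' : ∀ k < K, pieceEnd p p' q K k ≤ t → pieceEnd p p' q K (k + 1) < t := by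
    intro k hk hk1
    by_contra h2
    exact hcon ⟨k, hk, hk1, not_lt.1 h2⟩
  have key : ∀ k ≤ K, pieceEnd p p' q K k ≤ t := by
    intro k
    induction k with
    | zero => intro _; rw [pieceEnd_zero hq hK]; exact ht.1
    | succ k ih =>
        intro hk
        exact (hcon' k (by omega) (ih (by omega))).le
  have h1 := key K le_rfl
  rw [pieceEnd_last hq hK] at h1
  have h2 := hcon' (K - 1) (by omega) (key (K - 1) (by omega))
  rw [show K - 1 + 1 = K by omega, pieceEnd_last hq hK] at h2
  exact absurd ht.2 (not_le.2 h2)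

/-- **The checker.**  Scale `S`, `MC.expI` parameters `Kt`, `kr`; constants `C` and table `tab` of the rung; mode
radius `N`, integer coefficients `c`; block `[p/q, p'/q]` cut into `K` pieces.  Accept iff the form box lies strictly
below every piece's profile box. -/
def checkCert (S Kt kr yT : ℕ) (C : Consts) (tab : List IdxRec) (N : ℕ) (c : List ℤ) (p p' : ℤ) (q K : ℕ) : Bool :=
  let F := formBox S C tab N c (2 * N + 1)
  decide (0 < q) && decide (0 < K) &&
    (List.range K).all fun k ↦
      match profBox S Kt kr yT C tab N c (pieceBox S p p' q K k) (pieceCentre S p p' q K k) with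
      | some P => decide (F.hi < P.lo)
      | none => false

/-- The modes of a certificate as a finite set: `{i − N : i < 2N+1} = [−N, N]`. -/
def modes (N : ℕ) : Finset ℤ := (Finset.range (2 * N + 1)).image (mode N)

/-- The real coefficient vector of a certificate on `ℤ`: `x_n = c_{n+N}`. -/
def coefFun (N : ℕ) (c : List ℤ) (n : ℤ) : ℝ := ((coefAt c (n + N).toNat : ℤ) : ℝ)

/-- `mode N` is injective on the index range. -/
theorem mode_injOn (N : ℕ) : Set.InjOn (mode N) (Finset.range (2 * N + 1) : Set ℕ) := by
  intro i _ j _ h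
  unfold mode at h
  omega

/-- The coefficient function at the `i`-th mode is the `i`-th listed coefficient. -/
theorem coefFun_mode (N : ℕ) (c : List ℤ) (i : ℕ) : coefFun N c (mode N i) = ((coefAt c i : ℤ) : ℝ) := by
  unfold coefFun mode
  congr 2
  omega

/-- **SOUNDNESS OF THE CHECKER.**  If `checkCert` accepts then, with `m = (F.hi + ½)/S`, the Gram form of the
certificate's vector is `< m` and the profile of its window is `≥ m` on the whole block. -/
theorem certificate_sound {S : ℕ} (hS : 0 < S) (ha0 : 0 < a) (hks : PrimeData a ks) (hC : ConstsValid S a ks C)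
    (htab : TabValid S a ks Nt tab) {N : ℕ} (hN : N < Nt) {Kt kr yT : ℕ} {c : List ℤ} {p p' : ℤ} {q K : ℕ}
    (h : checkCert S Kt kr yT C tab N c p p' q K = true) :
    (∑ n ∈ modes N, ∑ k ∈ modes N, coefFun N c n * coefFun N c k * gramCoeff a n k <
        (((formBox S C tab N c (2 * N + 1)).hi : ℝ) + 1 / 2) / S) ∧
      ∀ t ∈ Icc ((p : ℝ) / q) ((p' : ℝ) / q),
        (((formBox S C tab N c (2 * N + 1)).hi : ℝ) + 1 / 2) / S ≤
          ‖weilMellin (∑ n ∈ modes N, (coefFun N c n : ℂ) • chi a n) (1 / 2 + t * I)‖ ^ 2 := by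
  unfold checkCert at h
  simp only [Bool.and_eq_true, decide_eq_true_eq, List.all_eq_true, List.mem_range] at h
  obtain ⟨⟨hq, hK⟩, hall⟩ := h
  have hSr : (0 : ℝ) < S := by exact_mod_cast hS
  set F := formBox S C tab N c (2 * N + 1) with hF
  constructor
  · -- the form
    have hform := mem_formBox hS ha0 hks hC htab hN c (2 * N + 1) le_rfl
    have hle := MI.le_hi_div hS hform
    have e : ∑ n ∈ modes N, ∑ k ∈ modes N, coefFun N c n * coefFun N c k * gramCoeff a n k =
        ∑ i ∈ Finset.range (2 * N + 1), ∑ j ∈ Finset.range (2 * N + 1),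
          gramCoeff a (mode N i) (mode N j) * ((coefAt c i * coefAt c j : ℤ) : ℝ) := by
      unfold modes
      rw [Finset.sum_image (mode_injOn N)]
      refine Finset.sum_congr rfl fun i _ ↦ ?_
      rw [Finset.sum_image (mode_injOn N)]
      refine Finset.sum_congr rfl fun j _ ↦ ?_
      rw [coefFun_mode, coefFun_mode]
      push_cast
      ring
    rw [e]
    calc _ ≤ (F.hi : ℝ) / S := hle
      _ < ((F.hi : ℝ) + 1 / 2) / S := by
          apply div_lt_div_of_pos_right _ hSr; linarith
  · -- the profile
    intro t ht
    obtain ⟨k, hk, h1, h2⟩ := exists_piece hq hK ht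
    have hT := mem_pieceBox S hq hK k h1 h2
    have hk' := hall k hk
    have hTc : MI.mem S (((p * (2 * (K : ℤ) - 2 * k - 1) + p' * (2 * k + 1) : ℤ) : ℝ) / ((2 * q * K : ℕ) : ℝ))
        (pieceCentre S p p' q K k) := MI.mem_ofFrac S _ (by positivity)
    split at hk'
    · rename_i P hP
      simp only [decide_eq_true_eq] at hk'
      have hprof := le_profile_of_profBox hS ha0 hC htab hN c hT hTc hP
      have e : ‖weilMellin (∑ n ∈ modes N, (coefFun N c n : ℂ) • chi a n) (1 / 2 + t * I)‖ ^ 2 =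
          2 * a * (∑ j ∈ Finset.range (2 * N + 1),
            ((coefAt c j : ℤ) : ℝ) * Real.sinc (a * t + π * (mode N j))) ^ 2 := by
        rw [norm_sq_weilMellin_sum_smul_chi_eq_sinc ha0]
        unfold modes
        rw [Finset.sum_image (mode_injOn N)]
        congr 2
        refine Finset.sum_congr rfl fun j _ ↦ ?_
        rw [coefFun_mode]
      rw [e]
      refine le_trans ?_ hprof
      have : ((F.hi : ℝ) + 1 / 2) ≤ (P.lo : ℝ) := by
        have : (F.hi : ℝ) + 1 ≤ (P.lo : ℝ) := by exact_mod_cast hk'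
        linarith
      exact div_le_div_of_nonneg_right this hSr.le
    · simp at hk'

/-! ## The certificates as theorems -/

/-- ★ **A CHRISTOFFEL CERTIFICATE EXCLUDES EVERY ARITHMETIC LINE FROM ITS BLOCK** (RH-free).  If `checkCert` accepts
for the constants/table of the rung `a` (valid below `Nt > N`), then every positive measure representing Weil's
form on the tests of `[-a, a]` that is ℕ-valued on bounded Borel sets vanishes on `[p/q, p'/q]`. -/
theorem measure_Icc_eq_zero_of_natValued_of_checkCert {S : ℕ} (hS : 0 < S) (ha0 : 0 < a) (hks : PrimeData a ks)
    (hC : ConstsValid S a ks C) (htab : TabValid S a ks Nt tab) {N : ℕ} (hN : N < Nt) {Kt kr yT : ℕ} {c : List ℤ}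
    {p p' : ℤ} {q K : ℕ} (h : checkCert S Kt kr yT C tab N c p p' q K = true) {μ : Measure ℝ}
    (hμ : ∀ g : ℝ → ℂ, IsWeilTest g → tsupport g ⊆ Icc (-a) a →
      Integrable (fun t : ℝ ↦ ‖weilMellin g (1 / 2 + t * I)‖ ^ 2) μ ∧
        weilQuadratic g = ((∫ t, ‖weilMellin g (1 / 2 + t * I)‖ ^ 2 ∂μ : ℝ) : ℂ))
    (hNv : ∀ s : Set ℝ, MeasurableSet s → Bornology.IsBounded s → ∃ k : ℕ, μ.real s = k) :
    μ (Icc ((p : ℝ) / q) ((p' : ℝ) / q)) = 0 := by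
  obtain ⟨hlt, hm⟩ := certificate_sound hS ha0 hks hC htab hN h
  exact measure_block_eq_zero_of_natValued_of_gramForm_lt ha0 hμ hNv (modes N) (coefFun N c) hm hlt

/-- ★ **A CHRISTOFFEL CERTIFICATE IS A ZERO-FREE BLOCK FOR `ζ`** (under RH).  If the Riemann hypothesis holds and
`checkCert` accepts for the rung `a`, no non-trivial zero of `ζ` has its ordinate in `[p/q, p'/q]`. -/
theorem im_not_mem_Icc_of_riemannHypothesis_of_checkCert (hRH : RiemannHypothesis) {S : ℕ} (hS : 0 < S)
    (ha0 : 0 < a) (hks : PrimeData a ks) (hC : ConstsValid S a ks C) (htab : TabValid S a ks Nt tab) {N : ℕ}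
    (hN : N < Nt) {Kt kr yT : ℕ} {c : List ℤ} {p p' : ℤ} {q K : ℕ} (h : checkCert S Kt kr yT C tab N c p p' q K = true)
    {ρ : ℂ} (hρ : ρ ∈ riemannZetaNontrivialZeros) :
    ρ.im ∉ Icc ((p : ℝ) / q) ((p' : ℝ) / q) := by
  obtain ⟨hlt, hm⟩ := certificate_sound hS ha0 hks hC htab hN h
  exact im_not_mem_block_of_riemannHypothesis_of_gramForm_lt hRH ha0 (modes N) (coefFun N c) hm hlt hρ

/-! ## Gluing blocks (used by the rung assemblies) -/

/-- Gluing two null blocks that share an endpoint. -/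
theorem measure_Icc_append {μ : Measure ℝ} {x y z : ℝ} (h1 : μ (Icc x y) = 0) (h2 : μ (Icc y z) = 0) :
    μ (Icc x z) = 0 := by
  refine measure_mono_null (fun t ht ↦ ?_) (measure_union_null h1 h2)
  rcases le_or_gt t y with h | h
  · exact Or.inl ⟨ht.1, h⟩
  · exact Or.inr ⟨h.le, ht.2⟩

/-- Gluing for the zero-location statements: no ordinate in `[x, y]` and none in `[y, z]` ⇒ none in `[x, z]`. -/
theorem not_mem_Icc_append {s x y z : ℝ} (h1 : s ∉ Icc x y) (h2 : s ∉ Icc y z) : s ∉ Icc x z := by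
  intro h
  rcases le_or_gt s y with h' | h'
  · exact h1 ⟨h.1, h'⟩
  · exact h2 ⟨h'.le, h.2⟩

/-- ℕ-valuedness on bounded Borel sets passes to the reflected measure. -/
theorem natValued_map_neg {μ : Measure ℝ}
    (hN : ∀ s : Set ℝ, MeasurableSet s → Bornology.IsBounded s → ∃ k : ℕ, μ.real s = k) :
    ∀ s : Set ℝ, MeasurableSet s → Bornology.IsBounded s → ∃ k : ℕ, (μ.map fun t : ℝ ↦ -t).real s = k := by
  intro s hs hb
  rw [map_measureReal_apply measurable_neg hs]
  refine hN _ (measurable_neg hs) ?_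
  obtain ⟨R, hR⟩ := isBounded_iff_forall_norm_le.1 hb
  exact isBounded_iff_forall_norm_le.2 ⟨R, fun x hx ↦ by simpa using hR (-x) hx⟩

/-- A null block of the reflected measure is a mirrored null block. -/
theorem measure_Icc_neg_of_map_neg {μ : Measure ℝ} {l r : ℝ} (h : (μ.map fun t : ℝ ↦ -t) (Icc l r) = 0) :
    μ (Icc (-r) (-l)) = 0 := by
  rw [Measure.map_apply measurable_neg measurableSet_Icc] at h
  have e : (fun t : ℝ ↦ -t) ⁻¹' Icc l r = Icc (-r) (-l) := by
    ext t; simp only [mem_preimage, mem_Icc]; constructor <;> intro ht <;> constructor <;> linarith [ht.1, ht.2]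
  rwa [e] at h

/-! ## Mass bounds above one: the multiplicity checker (at most `M − 1` lines in a block) -/

/-- **The multiplicity checker**: as `checkCert`, but accept iff `F.hi < M · P.lo` on every piece, so that the block's mass is `< M`. -/
def checkCertMul (S Kt kr yT : ℕ) (C : Consts) (tab : List IdxRec) (N : ℕ) (c : List ℤ) (p p' : ℤ) (q K M : ℕ) :
    Bool :=
  let F := formBox S C tab N c (2 * N + 1)
  decide (0 < q) && decide (0 < K) && decide (0 < M) &&
    (List.range K).all fun k ↦
      match profBox S Kt kr yT C tab N c (pieceBox S p p' q K k) (pieceCentre S p p' q K k) with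
      | some P => decide (F.hi < (M : ℤ) * P.lo)
      | none => false

end Christoffel

end Summit.Ventures.WeilGRH

end
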